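import Mathlib.MeasureTheory.Integral.Bochner.Basic
import Mathlib.MeasureTheory.Integral.IntegrableOn
import Mathlib.MeasureTheory.Measure.Typeclasses.Probability
import Mathlib.MeasureTheory.Measure.Real
import HarnessLib

/-!
# Kac chaos: the empirical measure from the first two marginals
(trunk: FluidKinetic / T-KINETIC; support for `Kinetic.TendstoMarginals.tendstoEmpirical`)

The abstract (measure-theoretic) half of "propagation of chaos implies the law of large numbers
for the empirical measure": Sznitman 1991 (LNM 1464) Prop. 2.2, implication (i) ⇒ (ii), in the
form and with the proof printed in Chaintron–Diez 2022, Lemma 3.19 (p. 32–33):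
for laws `P_N` of `N` particles and a bounded observable `φ`,

`E |⟨μ_{Z_N} − f, φ⟩|² = N⁻² ∑_{i,j} E[φ(z_i) φ(z_j)] − 2 ⟨f, φ⟩ N⁻¹ ∑_i E[φ(z_i)] + ⟨f, φ⟩²`,

so that if every one-particle expectation `E[φ(z_i)]` tends to `c = ⟨f, φ⟩` and every
two-particle expectation `E[φ(z_i) φ(z_j)]`, `i ≠ j`, tends to `c²` (for symmetric laws: if the
first two marginals converge weakly to `f`, `f ⊗ f`), then `⟨μ_{Z_N}, φ⟩ → c` in `L²`, hence in
probability (Chebyshev). We state the hypotheses index-wise ("for every `i`", "for every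
`i ≠ j`"), which is what symmetry of `P_N` provides, so no symmetry assumption is needed here.

* `Kinetic.empiricalAverage φ z = N⁻¹ ∑ φ(z_i)` (`= ∫ φ dμ_z`, cf.
  `Kinetic.integral_empiricalMeasure` in `BoltzmannGradLimit`);
* `Kinetic.integral_empiricalAverage_sq_le`: the variance bound
  `E[(N⁻¹ ∑ ψ(z_i))²] ≤ M²/N + b` if `|ψ| ≤ M` and `|E[ψ(z_i) ψ(z_j)]| ≤ b` for `i ≠ j`;
* `Kinetic.measureReal_lt_abs_empiricalAverage_le`: Chebyshev form;
* `Kinetic.tendsto_measure_empiricalAverage_sub` (Sznitman 1991 Prop. 2.2 (i)⇒(ii);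
  Chaintron–Diez 2022 Lemma 3.19): convergence in probability along `N_k → ∞`.

Mathlib has Markov/Chebyshev (`mul_meas_ge_le_integral_of_nonneg`, `ProbabilityTheory.variance`,
`meas_ge_le_variance_div_sq`) and the strong law for i.i.d. sequences
(`ProbabilityTheory.strong_law_ae`), but nothing on exchangeable arrays / Kac chaos (grep
`chaos|exchangeab|empirical measure`: only `Probability/IdentDistrib`, unrelated).

## References

* A.-S. Sznitman, *Topics in propagation of chaos*, LNM 1464 (1991), Prop. 2.2.
* L.-P. Chaintron, A. Diez, *Propagation of chaos: a review of models, methods and applications.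
  I. Models and methods*, Kinet. Relat. Models 15 (2022), Def. 3.18, Lemma 3.19
  (arXiv:2203.00446, p. 32–33).
-/

open MeasureTheory Filter Topology Finset

namespace Literature.Analysis.FluidPDE

noncomputable section

section Kinetic

variable {E : Type*}

/-- The *empirical average* of an observable `φ` over an `N`-particle configuration
`z = (z_i)_{i<N}`: `N⁻¹ ∑_i φ(z_i) = ∫ φ dμ_z` with `μ_z = N⁻¹ ∑ δ_{z_i}` the empirical measure
(Sznitman 1991 §I.2; Chaintron–Diez 2022 §3.1). Junk value `0` for `N = 0`. [cite: Sznitman1991, §I.2] -/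
def empiricalAverage {N : ℕ} (φ : E → ℝ) (z : Fin N → E) : ℝ :=
  (N : ℝ)⁻¹ * ∑ i, φ (z i)

/-- Unfolding lemma for the empirical average. [folklore] -/
theorem empiricalAverage_eq {N : ℕ} (φ : E → ℝ) (z : Fin N → E) :
    empiricalAverage φ z = (N : ℝ)⁻¹ * ∑ i, φ (z i) := rfl

/-- Centring: `N⁻¹ ∑ φ(z_i) − c = N⁻¹ ∑ (φ(z_i) − c)` for `N ≠ 0`. [folklore] -/
theorem empiricalAverage_sub_const {N : ℕ} (hN : N ≠ 0) (φ : E → ℝ) (c : ℝ) (z : Fin N → E) :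
    empiricalAverage φ z - c = empiricalAverage (fun x => φ x - c) z := by
  simp only [empiricalAverage, Finset.sum_sub_distrib, Finset.sum_const, Finset.card_univ,
    Fintype.card_fin, nsmul_eq_mul, mul_sub]
  rw [← mul_assoc, inv_mul_cancel₀ (by exact_mod_cast hN), one_mul]

/-- The square of an empirical average is a double average of products:
`(N⁻¹ ∑ ψ(z_i))² = N⁻² ∑_i ∑_j ψ(z_i) ψ(z_j)`. [folklore] -/
theorem empiricalAverage_sq {N : ℕ} (ψ : E → ℝ) (z : Fin N → E) :
    empiricalAverage ψ z ^ 2 = ((N : ℝ) ^ 2)⁻¹ * ∑ i, ∑ j, ψ (z i) * ψ (z j) := by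
  rw [empiricalAverage, mul_pow, sq (∑ i, ψ (z i)), Finset.sum_mul_sum, inv_pow]

/-- The empirical average of an observable bounded by `M ≥ 0` is bounded by `M` (the sign
condition only matters for `N = 0`). [folklore] -/
theorem abs_empiricalAverage_le {N : ℕ} {ψ : E → ℝ} {M : ℝ} (hM0 : 0 ≤ M) (hM : ∀ x, |ψ x| ≤ M)
    (z : Fin N → E) : |empiricalAverage ψ z| ≤ M := by
  rcases Nat.eq_zero_or_pos N with rfl | hN
  · simpa [empiricalAverage] using hM0
  · rw [empiricalAverage, abs_mul, abs_inv, Nat.abs_cast]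
    calc (N : ℝ)⁻¹ * |∑ i, ψ (z i)| ≤ (N : ℝ)⁻¹ * ∑ i, |ψ (z i)| := by
          gcongr; exact Finset.abs_sum_le_sum_abs _ _
      _ ≤ (N : ℝ)⁻¹ * ∑ _i : Fin N, M := by gcongr with i; exact hM _
      _ = M := by
        rw [Finset.sum_const, Finset.card_univ, Fintype.card_fin, nsmul_eq_mul, ← mul_assoc,
          inv_mul_cancel₀ (by exact_mod_cast hN.ne'), one_mul]

variable [MeasurableSpace E]

/-- The empirical average is measurable in the configuration for a measurable observable. [folklore] -/
theorem measurable_empiricalAverage {N : ℕ} {φ : E → ℝ} (hφ : Measurable φ) :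
    Measurable (empiricalAverage (N := N) φ) :=
  measurable_const.mul (Finset.measurable_sum _ fun i _ => hφ.comp (measurable_pi_apply i))

section Variance

variable {N : ℕ} {P : Measure (Fin N → E)} [IsProbabilityMeasure P]

/-- A bounded measurable observable of one particle is integrable against a law of `N`
particles. [folklore] -/
theorem integrable_comp_apply {ψ : E → ℝ} (hψ : Measurable ψ) {M : ℝ} (hM : ∀ x, |ψ x| ≤ M)
    (i : Fin N) : Integrable (fun z : Fin N → E => ψ (z i)) P :=
  Integrable.of_bound (hψ.comp (measurable_pi_apply i)).aestronglyMeasurable M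
    (Eventually.of_forall fun z => by simpa [Real.norm_eq_abs] using hM (z i))

/-- Products of bounded measurable one-particle observables are integrable. [folklore] -/
theorem integrable_comp_apply_mul {ψ : E → ℝ} (hψ : Measurable ψ) {M : ℝ} (hM : ∀ x, |ψ x| ≤ M)
    (i j : Fin N) : Integrable (fun z : Fin N → E => ψ (z i) * ψ (z j)) P := by
  refine Integrable.of_bound
    ((hψ.comp (measurable_pi_apply i)).mul (hψ.comp (measurable_pi_apply j))).aestronglyMeasurable
    (M * M) (Eventually.of_forall fun z => ?_)
  rw [Real.norm_eq_abs, abs_mul]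
  exact mul_le_mul (hM (z i)) (hM (z j)) (abs_nonneg _) ((abs_nonneg (ψ (z i))).trans (hM (z i)))

/-- The diagonal two-particle expectations are bounded by `M²`. [folklore] -/
theorem abs_integral_comp_apply_mul_le {ψ : E → ℝ} {M : ℝ} (hM : ∀ x, |ψ x| ≤ M)
    (i j : Fin N) : |∫ z, ψ (z i) * ψ (z j) ∂P| ≤ M ^ 2 := by
  calc |∫ z, ψ (z i) * ψ (z j) ∂P| ≤ ∫ z, |ψ (z i) * ψ (z j)| ∂P := abs_integral_le_integral_abs
    _ ≤ ∫ _z, M ^ 2 ∂P := by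
        refine integral_mono_of_nonneg (Eventually.of_forall fun z => abs_nonneg _)
          (integrable_const _) (Eventually.of_forall fun z => ?_)
        simp only [abs_mul, sq]
        exact mul_le_mul (hM (z i)) (hM (z j)) (abs_nonneg _)
          ((abs_nonneg (ψ (z i))).trans (hM (z i)))
    _ = M ^ 2 := by simp

/-- **Variance bound** (the computation in the proof of Chaintron–Diez 2022 Lemma 3.19;
Sznitman 1991 Prop. 2.2): if `|ψ| ≤ M` and the off-diagonal two-particle expectations satisfy
`|E[ψ(z_i) ψ(z_j)]| ≤ b` (`i ≠ j`, `0 ≤ b`), then `E[(N⁻¹ ∑ ψ(z_i))²] ≤ M² / N + b`. (For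
`N = 0` the left-hand side is `0` and `M² / N` is the junk `0`.) [cite: ChaintronDiez2022, Lemma 3.19 (proof)] -/
theorem integral_empiricalAverage_sq_le {ψ : E → ℝ} (hψ : Measurable ψ) {M : ℝ}
    (hM : ∀ x, |ψ x| ≤ M) {b : ℝ} (hb0 : 0 ≤ b)
    (hb : ∀ i j : Fin N, i ≠ j → |∫ z, ψ (z i) * ψ (z j) ∂P| ≤ b) :
    ∫ z, empiricalAverage ψ z ^ 2 ∂P ≤ M ^ 2 / N + b := by
  rcases Nat.eq_zero_or_pos N with rfl | hN
  · simp [empiricalAverage, hb0]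
  have hNr : (0 : ℝ) < N := by exact_mod_cast hN
  have hint : ∀ i j : Fin N, Integrable (fun z : Fin N → E => ψ (z i) * ψ (z j)) P :=
    fun i j => integrable_comp_apply_mul hψ hM i j
  -- expand the square and exchange integral and (finite) sums
  have hexp : ∫ z, empiricalAverage ψ z ^ 2 ∂P =
      ((N : ℝ) ^ 2)⁻¹ * ∑ i, ∑ j, ∫ z, ψ (z i) * ψ (z j) ∂P := by
    simp_rw [empiricalAverage_sq]
    rw [integral_const_mul, integral_finsetSum _ fun i _ => integrable_finsetSum _ fun j _ =>
      hint i j]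
    congr 1
    refine Finset.sum_congr rfl fun i _ => ?_
    rw [integral_finsetSum _ fun j _ => hint i j]
  -- bound each row: the diagonal term by `M²`, the others by `b ≤ b` and add the missing `j = i`
  have hrow : ∀ i : Fin N, ∑ j, ∫ z, ψ (z i) * ψ (z j) ∂P ≤ M ^ 2 + N * b := by
    intro i
    rw [← Finset.add_sum_erase _ _ (Finset.mem_univ i)]
    refine add_le_add ((le_abs_self _).trans (abs_integral_comp_apply_mul_le hM i i)) ?_
    calc ∑ j ∈ Finset.univ.erase i, ∫ z, ψ (z i) * ψ (z j) ∂P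
        ≤ ∑ j ∈ Finset.univ.erase i, b :=
          Finset.sum_le_sum fun j hj => (le_abs_self _).trans (hb i j (Finset.ne_of_mem_erase hj).symm)
      _ ≤ ∑ _j : Fin N, b := Finset.sum_le_sum_of_subset_of_nonneg (Finset.erase_subset _ _)
          fun _ _ _ => hb0
      _ = N * b := by simp
  rw [hexp]
  calc ((N : ℝ) ^ 2)⁻¹ * ∑ i, ∑ j, ∫ z, ψ (z i) * ψ (z j) ∂P
      ≤ ((N : ℝ) ^ 2)⁻¹ * ∑ _i : Fin N, (M ^ 2 + N * b) := by
        gcongr with i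
        exact hrow i
    _ = M ^ 2 / N + b := by
        simp only [Finset.sum_const, Finset.card_univ, Fintype.card_fin, nsmul_eq_mul]
        field_simp

/-- **Chebyshev form**: under the hypotheses of `integral_empiricalAverage_sq_le`, for `δ > 0`,
`P {δ < |N⁻¹ ∑ ψ(z_i)|} ≤ δ⁻² (M² / N + b)` (Chaintron–Diez 2022, proof of Lemma 3.19). [cite: ChaintronDiez2022, Lemma 3.19 (proof)] -/
theorem measureReal_lt_abs_empiricalAverage_le {ψ : E → ℝ} (hψ : Measurable ψ) {M : ℝ}
    (hM : ∀ x, |ψ x| ≤ M) {b : ℝ} (hb0 : 0 ≤ b)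
    (hb : ∀ i j : Fin N, i ≠ j → |∫ z, ψ (z i) * ψ (z j) ∂P| ≤ b) {δ : ℝ} (hδ : 0 < δ) :
    P.real {z | δ < |empiricalAverage ψ z|} ≤ (δ ^ 2)⁻¹ * (M ^ 2 / N + b) := by
  rcases Nat.eq_zero_or_pos N with rfl | hN
  · have : {z : Fin 0 → E | δ < |empiricalAverage ψ z|} = ∅ := by
      ext z; simp [empiricalAverage, not_lt.2 hδ.le]
    rw [this, measureReal_empty]
    simp only [CharP.cast_eq_zero, div_zero, zero_add]
    positivity
  have hmeas : Measurable fun z : Fin N → E => empiricalAverage ψ z ^ 2 :=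
    (measurable_empiricalAverage hψ).pow_const 2
  have hint : Integrable (fun z : Fin N → E => empiricalAverage ψ z ^ 2) P := by
    refine Integrable.of_bound hmeas.aestronglyMeasurable (M ^ 2) (Eventually.of_forall fun z => ?_)
    have hM0 : 0 ≤ M := (abs_nonneg _).trans (hM (z ⟨0, hN⟩))
    rw [Real.norm_eq_abs, abs_pow]
    exact pow_le_pow_left₀ (abs_nonneg _) (abs_empiricalAverage_le hM0 hM z) 2
  have hcheb := mul_meas_ge_le_integral_of_nonneg (μ := P)
    (Eventually.of_forall fun z => sq_nonneg (empiricalAverage ψ z)) hint (δ ^ 2)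
  have hsub : {z : Fin N → E | δ < |empiricalAverage ψ z|} ⊆
      {z | δ ^ 2 ≤ empiricalAverage ψ z ^ 2} := fun z hz => by
    have : δ ^ 2 < |empiricalAverage ψ z| ^ 2 := by
      simpa using pow_lt_pow_left₀ hz hδ.le two_ne_zero
    simpa [sq_abs] using this.le
  have hδ2 : 0 < δ ^ 2 := pow_pos hδ 2
  calc P.real {z | δ < |empiricalAverage ψ z|}
      ≤ P.real {z | δ ^ 2 ≤ empiricalAverage ψ z ^ 2} := measureReal_mono hsub
    _ ≤ (δ ^ 2)⁻¹ * ∫ z, empiricalAverage ψ z ^ 2 ∂P := by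
        rw [le_inv_mul_iff₀ hδ2]; exact hcheb
    _ ≤ (δ ^ 2)⁻¹ * (M ^ 2 / N + b) := by
        gcongr; exact integral_empiricalAverage_sq_le hψ hM hb0 hb

end Variance

/-- **Kac chaos from the first two marginals implies the law of large numbers for the
empirical measure** (Sznitman 1991 Prop. 2.2, (i) ⇒ (ii); Chaintron–Diez 2022 Lemma 3.19 with
its proof): let `P_k` be probability laws of `N_k → ∞` particles in `E` and `φ` a bounded
measurable observable such that every one-particle expectation `E_k[φ(z_i)]` equals `a_k → c`
and every off-diagonal two-particle expectation `E_k[φ(z_i) φ(z_j)]` (`i ≠ j`) equals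
`b_k → c²` (for symmetric `P_k` this is weak convergence of the first two marginals tested on
`φ`, `φ ⊗ φ`). Then `N_k⁻¹ ∑_i φ(z_i) → c` in `P_k`-probability:
`P_k {δ < |N_k⁻¹ ∑ φ(z_i) − c|} → 0` for every `δ > 0`. [cite: Sznitman1991, Prop. 2.2] -/
theorem tendsto_measure_empiricalAverage_sub {Nk : ℕ → ℕ} (hN : Tendsto Nk atTop atTop)
    (P : (k : ℕ) → Measure (Fin (Nk k) → E)) [∀ k, IsProbabilityMeasure (P k)]
    {φ : E → ℝ} (hφ : Measurable φ) {M : ℝ} (hM : ∀ x, |φ x| ≤ M) {c : ℝ} {a b : ℕ → ℝ}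
    (ha : ∀ k (i : Fin (Nk k)), ∫ z, φ (z i) ∂P k = a k)
    (hb : ∀ k (i j : Fin (Nk k)), i ≠ j → ∫ z, φ (z i) * φ (z j) ∂P k = b k)
    (ha' : Tendsto a atTop (𝓝 c)) (hb' : Tendsto b atTop (𝓝 (c ^ 2))) {δ : ℝ} (hδ : 0 < δ) :
    Tendsto (fun k => P k {z | δ < |empiricalAverage φ z - c|}) atTop (𝓝 0) := by
  -- centre the observable
  set ψ : E → ℝ := fun x => φ x - c with hψ_def
  have hψ : Measurable ψ := hφ.sub measurable_const
  have hMψ : ∀ x, |ψ x| ≤ M + |c| := fun x =>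
    (abs_sub _ _).trans (add_le_add (hM x) le_rfl)
  -- the centred two-particle expectations `b_k − 2 c a_k + c²` tend to `0`
  set b' : ℕ → ℝ := fun k => |b k - 2 * c * a k + c ^ 2| with hb'_def
  have hb'0 : Tendsto b' atTop (𝓝 0) := by
    have : Tendsto (fun k => b k - 2 * c * a k + c ^ 2) atTop (𝓝 (c ^ 2 - 2 * c * c + c ^ 2)) :=
      (hb'.sub (ha'.const_mul _)).add tendsto_const_nhds
    have h0 : c ^ 2 - 2 * c * c + c ^ 2 = 0 := by ring
    rw [h0] at this
    simpa using this.abs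
  have hbψ : ∀ k (i j : Fin (Nk k)), i ≠ j → |∫ z, ψ (z i) * ψ (z j) ∂P k| ≤ b' k := by
    intro k i j hij
    have h1 : ∫ z, ψ (z i) * ψ (z j) ∂P k = b k - 2 * c * a k + c ^ 2 := by
      have hi := integrable_comp_apply (P := P k) hφ hM i
      have hj := integrable_comp_apply (P := P k) hφ hM j
      have hij' := integrable_comp_apply_mul (P := P k) hφ hM i j
      have : (fun z : Fin (Nk k) → E => ψ (z i) * ψ (z j)) = fun z =>
          φ (z i) * φ (z j) - c * φ (z i) - c * φ (z j) + c ^ 2 := by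
        funext z; simp only [hψ_def]; ring
      rw [this, integral_add, integral_sub, integral_sub, integral_const_mul, integral_const_mul,
        hb k i j hij, ha k i, ha k j]
      · simp; ring
      · exact hij'
      · exact hi.const_mul c
      · exact hij'.sub (hi.const_mul c)
      · exact hj.const_mul c
      · exact (hij'.sub (hi.const_mul c)).sub (hj.const_mul c)
      · exact integrable_const _
    rw [h1]
  -- Chebyshev, then squeeze
  have hbound : ∀ k, Nk k ≠ 0 → (P k).real {z | δ < |empiricalAverage φ z - c|} ≤
      (δ ^ 2)⁻¹ * ((M + |c|) ^ 2 / Nk k + b' k) := by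
    intro k hk
    have := measureReal_lt_abs_empiricalAverage_le (P := P k) hψ hMψ (abs_nonneg _) (hbψ k) hδ
    have hset : {z : Fin (Nk k) → E | δ < |empiricalAverage φ z - c|} =
        {z | δ < |empiricalAverage ψ z|} := by
      ext z; rw [Set.mem_setOf_eq, Set.mem_setOf_eq, empiricalAverage_sub_const hk φ c]
    rw [hset]
    exact this
  have hlim : Tendsto (fun k => (δ ^ 2)⁻¹ * ((M + |c|) ^ 2 / Nk k + b' k)) atTop (𝓝 0) := by
    have h1 : Tendsto (fun k => (M + |c|) ^ 2 / (Nk k : ℝ)) atTop (𝓝 0) :=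
      tendsto_const_nhds.div_atTop (tendsto_natCast_atTop_atTop.comp hN)
    simpa using ((h1.add hb'0).const_mul (δ ^ 2)⁻¹)
  -- pass from `Measure.real` to `ℝ≥0∞`
  have hreal : Tendsto (fun k => (P k).real {z | δ < |empiricalAverage φ z - c|}) atTop (𝓝 0) := by
    refine squeeze_zero' (Eventually.of_forall fun k => measureReal_nonneg) ?_ hlim
    filter_upwards [hN.eventually_ge_atTop 1] with k hk
    exact hbound k (by omega)
  have : (fun k => P k {z | δ < |empiricalAverage φ z - c|}) =
      fun k => ENNReal.ofReal ((P k).real {z | δ < |empiricalAverage φ z - c|}) := by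
    funext k; rw [ofReal_measureReal]
  rw [this, ← ENNReal.ofReal_zero]
  exact ENNReal.tendsto_ofReal hreal

end Kinetic

end

end Literature.Analysis.FluidPDE
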